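import Summits.BirchSwinnertonDyer.BirchSwinnertonDyer.Theorems.ErratumRoadFiveNonSurjCornerFrobeniusOrders
import Literature.NumberTheory.Automorphic.CDTTheorem722SerreProofs
import Literature.NumberTheory.EllipticCurves.LFunctionPrimeCoeff
import HarnessLib

/-!
# Route `ErratumRoadFive` (K2), crux `NonSurjCorner` (19065) ∕ child `NonSurjCornerTwinMuAn` (19948):
# THE TRACE TEST READ ON THE NEWFORM — a weight-2 newform class `(f, ι)` with ONE coefficient `ι(a_ℓ(f))² = 3ℓ` in `𝔽̄₅` hosts no corner pair at `5`
# (cell `bsd-stepL`, WIDTH-LEVER lane B `bsd-stepL-corner5-p2` g10; `--supports stmt-BirchSwinnertonDyer-19948 --as helper`)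

WHY. Lane B's Serre-level census (HOME/corner5/g10) discards a newform class `(g, ℘ ∣ 5)` as «not a corner class» at the first good prime `ℓ` with
`a_ℓ(g)² ≡ 3ℓ (mod ℘)` (4 834 of the 4 892 classes of level ≤ 2 000). The kernel trace test (p630336) is a statement about the CURVE (`a_ℓ(E)² ≢ 3ℓ`); this
file reads it on the NEWFORM: if the framed mod-`5` representation of a curve `E` — multiplicative at `5`, `E[5]` irreducible, `ρ̄_{E,5}` not onto — is attached
to `(f, ιf)` off `S` (`IsGaloisRepOfNewform1Int`, as delivered by the Serre-level door p628991), then for every prime `ℓ ∉ S`, `ℓ ≠ 5`, good for `E`, and every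
integral lift `P ∈ 𝓞_f[X]` of the Hecke polynomial of `f` at `ℓ`: `ιf(P₁)² ≠ 3ℓ` in `𝔽̄₅` (`P₁` the `X`-coefficient, `= −a_ℓ(f)`). So a single witness prime
excludes the whole class — exactly the census sieve, now a kernel implication (the newform-side coefficient is the only datum taken from the computation).

HONEST FRAMING: structure theorem; no named fact used or added; nothing proves the crux, a stub or BSD for any class; closes: none (T7).
[cite: DeligneSerreASENS1974, Thm. 6.1, (6.1.1)] [cite: Serre1972, §2.6] [cite: Zywina2015, Thm. 1.4]
-/

set_option linter.dupNamespace false -- `Summit.BirchSwinnertonDyer.BirchSwinnertonDyer` (summit = problem), tree-wide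

noncomputable section

open scoped Classical MatrixGroups ModularForm NumberField

namespace Summit.BirchSwinnertonDyer.BirchSwinnertonDyer.Theorems.CornerShape

open CongruenceSubgroup WeierstrassCurve Literature.NumberTheory.EllipticCurves
  Literature.NumberTheory.EllipticCurves.ModularForms
  Literature.NumberTheory.EllipticCurves.Rank1Residual
  Literature.NumberTheory.GaloisRepresentations Literature.NumberTheory.Automorphic
  Literature.NumberTheory.Automorphic.BCDT
  IsDedekindDomain IsDedekindDomain.HeightOneSpectrum Rat.HeightOneSpectrum NumberField Polynomial
  Summit.BirchSwinnertonDyer.Rank1Residual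

/-- **The `X`-coefficient of the Hecke polynomial, read in `𝔽̄_p`, is minus the trace of the curve.** If the framed mod-`p` representation `ρ` of a globally
minimal `E/ℚ` (base-changed to `𝔽̄_p`) is attached to the newform `f` via `ιf` off `S`, then at every prime `ℓ ∉ S`, `ℓ ≠ p`, of good reduction, for every
integral lift `P` of the Hecke polynomial of `f` at `ℓ`: `ιf(P₁) = −a_ℓ(E)` in `𝔽̄_p` (both sides are the `X`-coefficient of the Frobenius polynomial at `ℓ`).
[cite: DeligneSerreASENS1974, Thm. 6.1, (6.1.1)] [cite: DarmonDiamondTaylor1995, Prop. 2.11 (a)] -/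
theorem map_coeff_one_heckeLift_eq_neg_frobeniusTrace
    (W : WeierstrassCurve ℚ) [W.IsElliptic] [W.IsGloballyMinimal] (p : ℕ) [Fact p.Prime]
    [TopologicalSpace (AlgebraicClosure (ZMod p))] [DiscreteTopology (AlgebraicClosure (ZMod p))]
    {ρ : ModPGaloisRep ℚ (ZMod p) 2} (hρ : W.IsTorsionGaloisRep p ρ)
    {M : ℕ} [NeZero M] {f : CuspForm (Gamma1 M) 2} (ιf : coeffCharIntegers f →+* AlgebraicClosure (ZMod p)) (S : Set ℕ)
    (h : IsGaloisRepOfNewform1Int f ιf S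
      (FramedRep.baseChange (algebraMap (ZMod p) (AlgebraicClosure (ZMod p))) continuous_of_discreteTopology ρ))
    (ℓ : ℕ) [hℓ : Fact ℓ.Prime] (hℓS : ℓ ∉ S) (hℓp : ℓ ≠ p) (hg : W.HasGoodReductionAtPrime ℓ)
    (P : Polynomial (coeffCharIntegers f)) (hP : P.map (algebraMap (coeffCharIntegers f) (coeffCharField f)) = heckePolynomial f ℓ) :
    ιf (P.coeff 1) = -(algebraMap (ZMod p) (AlgebraicClosure (ZMod p)) (W.frobeniusTrace ℓ : ZMod p)) := by
  set j : ZMod p →+* AlgebraicClosure (ZMod p) := algebraMap (ZMod p) (AlgebraicClosure (ZMod p)) with hj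
  obtain ⟨v, rfl⟩ : ∃ v : HeightOneSpectrum (𝓞 ℚ), (primesEquiv v : ℕ) = ℓ :=
    ⟨primesEquiv.symm ⟨ℓ, hℓ.out⟩, by rw [Equiv.apply_symm_apply]⟩
  obtain ⟨𝔓, h𝔓⟩ := HeightOneSpectrum.primesAbove_nonempty v
  obtain ⟨σ, hσ⟩ := HeightOneSpectrum.exists_isArithFrobAt_of_mem_primesAbove_holds h𝔓
  obtain ⟨-, P', hP', hP'c⟩ := h v hℓS
  have hPP : P' = P :=
    Polynomial.map_injective (algebraMap (coeffCharIntegers f) (coeffCharField f)) (fun _ _ e ↦ Subtype.ext e)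
      (hP'.trans hP.symm)
  have hc : FramedRep.charpoly (FramedRep.baseChange j continuous_of_discreteTopology ρ) σ = P.map ιf := hPP ▸ hP'c 𝔓 h𝔓 σ hσ
  have hgv : W.HasGoodReductionAt v := (W.hasGoodReductionAtPrime_iff_hasGoodReductionAt_ringOfIntegers (v := v)).mp hg
  have e := charpoly_baseChange_of_isTorsionGaloisRep W hρ j continuous_of_discreteTopology hℓp hgv h𝔓 hσ
  have hX : (P.map ιf).coeff 1 = (X ^ 2 - C ((W.LFunction (primesEquiv v : ℕ) : ℤ) : AlgebraicClosure (ZMod p)) * X +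
      C ((primesEquiv v : ℕ) : AlgebraicClosure (ZMod p))).coeff 1 := by rw [← e, hc]
  simp only [coeff_map, coeff_add, coeff_sub, coeff_C_mul, coeff_X_pow, coeff_X_one, coeff_C,
    if_neg (show (1 : ℕ) ≠ 2 by decide), if_neg (show (1 : ℕ) ≠ 0 by decide), mul_one, zero_sub, add_zero] at hX
  rw [hX, W.LFunction_apply_prime_eq_frobeniusTrace _ hg]
  simp only [map_intCast]

/-- **THE TRACE TEST ON THE NEWFORM CLASS (p = 5).** `E/ℚ` globally minimal, multiplicative at `5`, `E[5]` irreducible, `ρ̄_{E,5}` not onto, its framed mod-`5`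
representation attached to the newform class `(f, ιf)` off `S`. Then for every prime `ℓ ∉ S`, `ℓ ≠ 5`, of good reduction and every integral lift `P` of the
Hecke polynomial of `f` at `ℓ`: `ιf(P₁)² ≠ 3ℓ` in `𝔽̄₅`. Contrapositively: a class with ONE witness prime (`ι(a_ℓ(f))² = 3ℓ`) contains no such curve — the
census sieve. [cite: Serre1972, §2.6] [cite: Zywina2015, Thm. 1.4] [cite: DeligneSerreASENS1974, Thm. 6.1] -/
theorem NonSurjCorner.newformClass_traceTest_five
    (W : WeierstrassCurve ℚ) [W.IsElliptic] [W.IsGloballyMinimal] [Fact (Nat.Prime 5)]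
    (hmult : Mult W 5) (hirr : Irr W 5) (hns : ¬ Surj W 5)
    [TopologicalSpace (AlgebraicClosure (ZMod 5))] [DiscreteTopology (AlgebraicClosure (ZMod 5))]
    {ρ : ModPGaloisRep ℚ (ZMod 5) 2} (hρ : W.IsTorsionGaloisRep 5 ρ)
    {M : ℕ} [NeZero M] {f : CuspForm (Gamma1 M) 2} (ιf : coeffCharIntegers f →+* AlgebraicClosure (ZMod 5)) (S : Set ℕ)
    (h : IsGaloisRepOfNewform1Int f ιf S
      (FramedRep.baseChange (algebraMap (ZMod 5) (AlgebraicClosure (ZMod 5))) continuous_of_discreteTopology ρ))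
    (ℓ : ℕ) [Fact ℓ.Prime] (hℓS : ℓ ∉ S) (hℓ5 : ℓ ≠ 5) (hg : W.HasGoodReductionAtPrime ℓ)
    (P : Polynomial (coeffCharIntegers f)) (hP : P.map (algebraMap (coeffCharIntegers f) (coeffCharField f)) = heckePolynomial f ℓ) :
    (ιf (P.coeff 1)) ^ 2 ≠ 3 * (ℓ : AlgebraicClosure (ZMod 5)) := by
  have key := NonSurjCorner.frobeniusTrace_sq_sub_three_mul_ne_zero_five W hmult hirr hns ℓ hℓ5 hg
  rw [map_coeff_one_heckeLift_eq_neg_frobeniusTrace W 5 hρ ιf S h ℓ hℓS hℓ5 hg P hP, neg_sq]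
  intro habs
  apply key
  apply (algebraMap (ZMod 5) (AlgebraicClosure (ZMod 5))).injective
  rw [map_zero, Int.cast_sub, Int.cast_pow, Int.cast_mul, Int.cast_natCast, Int.cast_ofNat, map_sub, map_pow, habs, map_mul,
    map_natCast, map_ofNat, sub_self]

end Summit.BirchSwinnertonDyer.BirchSwinnertonDyer.Theorems.CornerShape

end
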